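import Literature.MathematicalPhysics.QuantumLattice.DWaveOrderParameterInfiniteVolume
import Literature.MathematicalPhysics.QuantumLattice.DWaveSourceNNNHoppingGroundEnergyEven
import Literature.MathematicalPhysics.QuantumLattice.DWaveOrderParameterRightDerivative
import HarnessLib

/-!
# The `d`-wave pair amplitudes of the translation-invariant ground states of the `t–t'` Hubbard interaction fill
# `[−m*, m*]` symmetrically; off a countable set of sources all translation-invariant sourced ground states agree

Topic `Literature/MathematicalPhysics/QuantumLattice` (namespace = path). Short sequel of
`DWaveOrderParameterInfiniteVolume.lean` (hubbard-cq-p5: range / attainment of `2 Re ω(P₀^d)` over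
translation-invariant sourced ground states, `m* = −∂⁺E(0)/2`) using the EVENNESS of
`E := dWaveSourceEnergyDensityTT' t' U μ` (hubbard-cq-obsth-2, `DWaveSourceNNNHoppingGroundEnergyEven.lean`)
and the countable-kink lemma of `DWaveOrderParameterRightDerivative.lean`. Hubbard cuprate cell (`hubbard-cq`),
rung CQ, rows PC-a / PC-c, both anchors (`t'` a parameter). Everything is PROVED; no definition, no named
fact, zero compute. (`m* := dWaveOrderParameterTT' t' U μ`, `P₀^d := localPairAt ({0} ∪ unitSteps) dWaveFormFactor 0`;
"ground state" = mean-energy minimiser of `hubbardTTPrimeMuInteraction 1 t' U μ`.)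

## Contents
* `leftDeriv_dWaveSourceEnergyDensityTT'_zero`: `∂⁻E(0) = 2m* (= −∂⁺E(0))` — the kink at zero source is symmetric.
* `countable_not_differentiableAt_dWaveSourceEnergyDensityTT'` (kinks of `E` countable) and
  `countable_setOf_exists_minimisers_ne`: off a countable set of sources `h`, ALL translation-invariant sourced
  ground states at `h` have the same pair amplitude (`= −E′(h) = lim_L 2 m_{L+1}(h)`).
* ZERO-FIELD RANGE, symmetric form: every translation-invariant ground state has `−m* ≤ Re ω(P₀^d)`
  (`IsMeanEnergyMinimiser.neg_dWaveOrderParameterTT'_le_re_expect_localPairAt`), hence `|Re ω(P₀^d)| ≤ m*`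
  (`…abs_re_expect_localPairAt_le_dWaveOrderParameterTT'`); `−m*` is ATTAINED
  (`exists_isMeanEnergyMinimiser_re_expect_localPairAt_eq_neg_dWaveOrderParameterTT'`, the `h → 0⁻`
  quasi-average state) and `isLeast_…`; with `DWaveOrderParameterQuasiAverageState.lean` (`+m*` attained,
  `isGreatest_…`) the real `d`-wave amplitudes of the translation-invariant infinite-volume ground states fill
  EXACTLY `[−m*, m*]`.

## What is NOT here
The full `U(1)` orbit `|ω(P₀^d)| ≤ m*` (needs the gauge action on infinite-volume states, not in the tree);
anything about long-range order.

## References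
* T. Koma, H. Tasaki, J. Stat. Phys. 76 (1994) 745–803, §1. [cite: KomaTasaki1994, §1]
* R. B. Griffiths, Phys. Rev. 152 (1966) 240–246, §II. [cite: Griffiths1966, §II]
* R. T. Rockafellar, *Convex Analysis* (1970), Thm. 25.3. [cite: Rockafellar1970, Thm. 25.3]
-/

noncomputable section

namespace Literature.MathematicalPhysics.QuantumLattice

open _root_.Matrix Finset HubbardWave0 Literature.Probability.LatticeModels _root_.Filter Set
open scoped _root_.Topology ComplexOrder

/-! ### The symmetric kink at zero source -/

section Kink

variable (t' U μ : ℝ)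

/-- **`∂⁻E(0) = 2m* = −∂⁺E(0)`**: the kink at zero source is symmetric. [cite: Griffiths1966, §II] -/
theorem leftDeriv_dWaveSourceEnergyDensityTT'_zero :
    derivWithin (dWaveSourceEnergyDensityTT' t' U μ) (Iio 0) 0 = 2 * dWaveOrderParameterTT' t' U μ := by
  have hL := (hasDerivWithinAt_Ioi_Iio_dWaveSourceEnergyDensityTT' t' U μ 0).2
  have hsl : Tendsto (slope (dWaveSourceEnergyDensityTT' t' U μ) 0) (𝓝[<] 0)
      (𝓝 (derivWithin (dWaveSourceEnergyDensityTT' t' U μ) (Iio 0) 0)) :=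
    (hasDerivWithinAt_iff_tendsto_slope' self_notMem_Iio).1 hL
  exact tendsto_nhds_unique hsl (tendsto_slope_dWaveSourceEnergyDensityTT'_nhdsLT_zero t' U μ)

end Kink

/-! ### Off the countable kink set, all translation-invariant sourced ground states share one pair amplitude -/

section Kinks

variable (t' U μ : ℝ)

/-- **The kinks of `E` are countable** (`t–t'` twin of `countable_not_differentiableAt_dWaveSourceEnergyDensity`;
concavity). [cite: Rockafellar1970, Thm. 25.3] -/
theorem countable_not_differentiableAt_dWaveSourceEnergyDensityTT' :
    Set.Countable {h : ℝ | ¬ DifferentiableAt ℝ (dWaveSourceEnergyDensityTT' t' U μ) h} := by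
  have key := countable_not_differentiableAt_of_convexOn_univ (concaveOn_dWaveSourceEnergyDensityTT' t' U μ).neg
  refine key.mono fun h hh => ?_
  simp only [Set.mem_setOf_eq] at hh ⊢
  intro hd
  exact hh (by simpa using hd.neg)

/-- **For all but countably many sources `h`, every translation-invariant sourced ground state at `h` has the
SAME `d`-wave pair amplitude `2 Re ω(P₀^d) = −E′(h)`, and the finite-torus sourced densities converge to it**:
the exceptional set is contained in the (countable) kink set of `E`. [cite: Griffiths1966, §II] -/
theorem countable_setOf_exists_minimisers_ne :
    Set.Countable {h : ℝ | ∃ ω ω' : InfVolFermionState 2,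
      ω.IsMeanEnergyMinimiser (hubbardTTPrimeSourcedInteraction 1 t' U μ dWaveFormFactor h) 1 ∧
      ω'.IsMeanEnergyMinimiser (hubbardTTPrimeSourcedInteraction 1 t' U μ dWaveFormFactor h) 1 ∧
        (ω.expect (pairRegion (insert (0 : Site 2) unitSteps) 0)
            (localPairAt (insert 0 unitSteps) dWaveFormFactor 0)).re ≠
          (ω'.expect (pairRegion (insert (0 : Site 2) unitSteps) 0)
            (localPairAt (insert 0 unitSteps) dWaveFormFactor 0)).re} := by
  refine (countable_not_differentiableAt_dWaveSourceEnergyDensityTT' t' U μ).mono ?_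
  rintro h ⟨ω, ω', hω, hω', hne⟩
  simp only [Set.mem_setOf_eq]
  intro hd
  exact hne ((differentiableAt_dWaveSourceEnergyDensityTT'_iff_forall_minimisers t' U μ h).1 hd ω ω' hω hω')

end Kinks


/-! ### Zero-field range of the pair amplitude, symmetric form: `[−m*, m*]`, both ends attained -/

section ZeroFieldRange

variable {t' U μ : ℝ} {ω : InfVolFermionState 2}

/-- **Every translation-invariant ground state of the grand-canonical `t–t'` Hubbard interaction has
`−m* ≤ Re ω(P₀^d)`** (the lower end of the zero-field range, by evenness of `E`). [cite: KomaTasaki1994, §1] -/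
theorem InfVolFermionState.IsMeanEnergyMinimiser.neg_dWaveOrderParameterTT'_le_re_expect_localPairAt
    (hω : ω.IsMeanEnergyMinimiser (hubbardTTPrimeMuInteraction 1 t' U μ) 1) :
    -dWaveOrderParameterTT' t' U μ ≤ (ω.expect (pairRegion (insert (0 : Site 2) unitSteps) 0)
        (localPairAt (insert 0 unitSteps) dWaveFormFactor 0)).re := by
  rw [← hubbardTTPrimeSourcedInteraction_zero_source 1 t' U μ dWaveFormFactor] at hω
  have h := hω.two_mul_re_expect_localPairAt_mem_Icc.1
  rw [leftDeriv_dWaveSourceEnergyDensityTT'_zero] at h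
  linarith

/-- **`|Re ω(P₀^d)| ≤ m*` for every translation-invariant ground state** of the grand-canonical `t–t'`
Hubbard interaction. [cite: KomaTasaki1994, §1] -/
theorem InfVolFermionState.IsMeanEnergyMinimiser.abs_re_expect_localPairAt_le_dWaveOrderParameterTT'
    (hω : ω.IsMeanEnergyMinimiser (hubbardTTPrimeMuInteraction 1 t' U μ) 1) :
    |(ω.expect (pairRegion (insert (0 : Site 2) unitSteps) 0)
        (localPairAt (insert 0 unitSteps) dWaveFormFactor 0)).re| ≤ dWaveOrderParameterTT' t' U μ := by
  refine abs_le.2 ⟨hω.neg_dWaveOrderParameterTT'_le_re_expect_localPairAt, ?_⟩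
  rw [← hubbardTTPrimeSourcedInteraction_zero_source 1 t' U μ dWaveFormFactor] at hω
  have h := hω.two_mul_re_expect_localPairAt_mem_Icc.2
  rw [dWaveOrderParameterTT'_eq_neg_half_rightDeriv]
  linarith

variable (t' U μ)

/-- **The lower end `−m*` is attained**: some translation-invariant ground state has `Re ω(P₀^d) = −m*`
(the `h → 0⁻` quasi-average state). [cite: KomaTasaki1994, §1] -/
theorem exists_isMeanEnergyMinimiser_re_expect_localPairAt_eq_neg_dWaveOrderParameterTT' :
    ∃ ω : InfVolFermionState 2, ω.IsMeanEnergyMinimiser (hubbardTTPrimeMuInteraction 1 t' U μ) 1 ∧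
      (ω.expect (pairRegion (insert (0 : Site 2) unitSteps) 0)
        (localPairAt (insert 0 unitSteps) dWaveFormFactor 0)).re = -dWaveOrderParameterTT' t' U μ := by
  obtain ⟨ω, hω, hωe⟩ :=
    exists_isMeanEnergyMinimiser_two_mul_re_expect_localPairAt_eq_neg_leftDeriv t' U μ 0
  rw [hubbardTTPrimeSourcedInteraction_zero_source] at hω
  refine ⟨ω, hω, ?_⟩
  rw [leftDeriv_dWaveSourceEnergyDensityTT'_zero] at hωe
  linarith

/-- **The zero-field range is exactly `[−m*, m*]`**: the set of real `d`-wave amplitudes `Re ω(P₀^d)` of the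
translation-invariant ground states has least element `−m*` (and greatest element `m*`,
`isGreatest_re_expect_localPairAt_groundStates_dWaveOrderParameterTT'`). [cite: KomaTasaki1994, §1] -/
theorem isLeast_re_expect_localPairAt_groundStates_neg_dWaveOrderParameterTT' :
    IsLeast ((fun ω : InfVolFermionState 2 => (ω.expect (pairRegion (insert (0 : Site 2) unitSteps) 0)
        (localPairAt (insert 0 unitSteps) dWaveFormFactor 0)).re) ''
        {ω | ω.IsMeanEnergyMinimiser (hubbardTTPrimeMuInteraction 1 t' U μ) 1})
      (-dWaveOrderParameterTT' t' U μ) := by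
  obtain ⟨ω, hω, hωe⟩ := exists_isMeanEnergyMinimiser_re_expect_localPairAt_eq_neg_dWaveOrderParameterTT' t' U μ
  refine ⟨⟨ω, hω, hωe⟩, ?_⟩
  rintro _ ⟨ω', hω', rfl⟩
  exact hω'.neg_dWaveOrderParameterTT'_le_re_expect_localPairAt

end ZeroFieldRange

end Literature.MathematicalPhysics.QuantumLattice

end
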